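import Literature.MathematicalPhysics.QuantumLattice.ReflectedCorrelationLogConvexity
import Literature.MathematicalPhysics.QuantumFieldTheory.SpeciesLatticeProducts
import Literature.MathematicalPhysics.QuantumFieldTheory.ConstructiveQFTWave0OddRPProofs
import Literature.MathematicalPhysics.QuantumFieldTheory.LatticeGaugeProofs
import Summits.QuantumFields.YangMills.Theorems.FradkinShenkerFlowFiniteSusceptibilityWeakCouplingRPCauchySchwarz
import HarnessLib

/-!
# Crux `LatticeGapOnTrajectory` (stmt-QuantumFields-10523): Hankel log-convexity of reflected
# autocorrelations ON THE ODD WILSON TORUS (transfer infrastructure, lead a2)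

Helper file (`--supports stmt-QuantumFields-10523`). Instantiates the abstract
`Literature/MathematicalPhysics/QuantumLattice/ReflectedCorrelationLogConvexity` on the torus
`(ℤ/(2S+1))⁴` with Wilson's measure `μ = wilsonMeasure ρ β` (`β ≥ 0`, `S ≥ 1`), the odd-torus time
reflection `Θ = GaugeConfig.timeReflect` (`θ t = 1 − t`, reflection positive on observables of the
positive half `oPosEdges ∪ oSharedEdges`: tree `wilsonExpectation_oddReflectionPositive`) and the time
shift `τ = torusTimeShift (2S+1) 1` (`(τU)(x,i) = U(x + e₀, i)`):

* `torusConfigShift_timeReflect_comm` — the intertwining `τ ∘ Θ = Θ ∘ τ⁻¹`;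
* `osVar_timeReflect_nonneg` — reflection positivity in OS-variance form, `0 ≤ osVar μ Θ Z`, for
  bounded measurable `Z` depending on the positive half;
* `dependsOn_comp_timeShift_iterate` — a slab observable (links based at lattice times `1 … w`)
  shifted by `j` depends on the slab `1 + j … w + j`, inside the positive half while `w + j ≤ S`;
* **`norm_osCorr_timeShift_pow_le`** — for such `X` and `2^J m + w ≤ S`:
  `‖osCorr μ Θ τ^m X X‖^(2^J) ≤ (osVar μ Θ X)^(2^J − 1) · ‖osCorr μ Θ τ^(2^J m) X X‖`;
* **`norm_osCorr_timeShift_le_of_decay`** — hence any far-separation bound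
  `‖osCorr μ Θ τ^(2^J m) X X‖ ≤ C e^{−κ 2^J m}` (sup-norm clustering) gives the OS-currency bound
  `‖osCorr μ Θ τ^m X X‖ ≤ ((osVar X)^(2^J−1) C)^{2^{-J}} e^{−κ m}` at the SAME rate.

Transfer use (crux NOTES.md §a2-B): with sup-norm constants polynomial in the cutoff and physical volume
`a_k L_k ≫ log(1/a_k)` the prefactor tends to the OS variance (`tendsto_pow_pred_mul_rpow_inv`) — no
transfer-matrix spectral theorem, no `TorusOSGapSlack` hypothesis (which is phrased with `negReflect`;
the two reflections of the odd torus are conjugate by a time shift).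
References: Osterwalder–Seiler 1978 §2; Glimm–Jaffe 1987 §6.1, §19.7; Fröhlich–Israel–Lieb–Simon 1978 §2.
-/

open scoped ComplexConjugate
open Filter MeasureTheory
open Literature.MathematicalPhysics.QuantumLattice Literature.MathematicalPhysics.QuantumFieldTheory
open Literature.Probability.LatticeModels (Torus.proj)

noncomputable section

namespace Summit.QuantumFields.YangMills.Cruxes.LatticeGapOnTrajectory.OrbitKantorovichFiniteSize

namespace Transfer

namespace Hankel

variable {G : Type} [Group G] [TopologicalSpace G] [IsTopologicalGroup G] [CompactSpace G]
  [MeasurableSpace G] [BorelSpace G] {N : ℕ} (ρ : G →* Matrix (Fin N) (Fin N) ℂ)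

/-! ## §1 Geometry of the time shift and the odd-torus reflection -/

section Geometry

variable {Sd : ℕ}

omit [TopologicalSpace G] [IsTopologicalGroup G] [CompactSpace G] [MeasurableSpace G] [BorelSpace G] in
/-- Reflecting a time-translated site: `θ (x − c e₀) = θ x + c e₀` for `θ t = 1 − t`. [folklore] -/
theorem timeReflect_sub_single [NeZero Sd] (x : Site 4 Sd) (c : ZMod Sd) :
    (x - Pi.single 0 c).timeReflect = x.timeReflect + Pi.single 0 c := by
  funext k
  by_cases hk : k = 0
  · subst hk
    simp only [WilsonRP.timeReflect_apply_zero, Pi.sub_apply, Pi.add_apply, Pi.single_eq_same]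
    ring
  · simp only [WilsonRP.timeReflect_apply_of_ne _ hk, Pi.sub_apply, Pi.add_apply,
      Pi.single_eq_of_ne hk, sub_zero, add_zero]

omit [TopologicalSpace G] [IsTopologicalGroup G] [CompactSpace G] [MeasurableSpace G] [BorelSpace G] in
/-- Reflecting a time-translated link: `edgeReflect (x − c e₀, i) = ((edgeReflect (x, i)).1 + c e₀, i)`.
[folklore] -/
theorem edgeReflect_sub_single [NeZero Sd] (x : Site 4 Sd) (i : Fin 4) (c : ZMod Sd) :
    WilsonRP.edgeReflect (x - Pi.single 0 c, i) =
      ((WilsonRP.edgeReflect (x, i)).1 + Pi.single 0 c, i) := by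
  unfold WilsonRP.edgeReflect
  by_cases hi : i = 0
  · subst hi
    simp only [↓reduceIte, Prod.mk.injEq, and_true]
    have : (x - Pi.single 0 c).shift 0 = x.shift 0 - Pi.single 0 c := by
      simp only [Site.shift]; abel
    rw [this, timeReflect_sub_single]
  · simp only [hi, ↓reduceIte, Prod.mk.injEq, and_true]
    exact timeReflect_sub_single x c

omit [TopologicalSpace G] [IsTopologicalGroup G] [CompactSpace G] [BorelSpace G] in
/-- **The intertwining `τ_v ∘ Θ = Θ ∘ τ_{−v}`** for a time translation `v = c e₀` on the torus:
`torusConfigShift v (ΘU) = Θ (torusConfigShift (−v) U)`. [folklore] -/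
theorem torusConfigShift_timeReflect_comm [NeZero Sd] (c : ZMod Sd) (U : GaugeConfig 4 Sd G) :
    torusConfigShift (Pi.single 0 c) U.timeReflect =
      (torusConfigShift (-Pi.single 0 c) U).timeReflect := by
  funext e
  obtain ⟨x, i⟩ := e
  rw [torusConfigShift_apply, WilsonRP.timeReflect_apply, WilsonRP.timeReflect_apply]
  simp only [torusConfigShift_apply, sub_neg_eq_add]
  rw [edgeReflect_sub_single]
  by_cases hi : i = 0
  · simp only [hi, ↓reduceIte]
    unfold WilsonRP.edgeReflect
    simp
  · simp only [hi, ↓reduceIte]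
    unfold WilsonRP.edgeReflect
    simp [hi]

omit [Group G] [TopologicalSpace G] [IsTopologicalGroup G] [CompactSpace G] [BorelSpace G] in
/-- The unit time shift is the torus translation by `−e₀`: `torusTimeShift Sd 1 = torusConfigShift (−e₀)`
as functions. [folklore] -/
theorem coe_torusTimeShift_one :
    ⇑(torusTimeShift (G := G) Sd 1) = ⇑(torusConfigShift (G := G) (-(Pi.single 0 (1 : ZMod Sd)) : _)) := by
  have h : Torus.proj Sd (-(Pi.single 0 ((1 : ℕ) : ℤ))) = -(Pi.single 0 (1 : ZMod Sd) : Site 4 Sd) := by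
    funext i
    by_cases hi : i = 0
    · subst hi; simp [Torus.proj]
    · simp [Torus.proj, Pi.single_eq_of_ne hi]
  unfold torusTimeShift
  rw [h]

omit [Group G] [TopologicalSpace G] [IsTopologicalGroup G] [CompactSpace G] [BorelSpace G] in
/-- Iterating the unit time shift `m` times is the time shift by `m`. [folklore] -/
theorem torusTimeShift_one_iterate (m : ℕ) :
    (⇑(torusTimeShift (G := G) Sd 1))^[m] = ⇑(torusTimeShift (G := G) Sd m) := by
  induction m with
  | zero => funext U; simp
  | succ m ih =>
    rw [Function.iterate_succ', ih]
    funext U e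
    simp only [Function.comp_apply, torusTimeShift, torusConfigShift_apply]
    congr 1
    refine Prod.ext ?_ rfl
    funext i
    simp only [Pi.sub_apply, Torus.proj, Pi.neg_apply]
    by_cases hi : i = 0
    · subst hi; simp; ring
    · simp [Pi.single_eq_of_ne hi]

end Geometry

/-! ## §2 Reflection positivity in OS-variance form -/

section RP

variable {S : ℕ}

/-- **Reflection positivity of the odd Wilson torus in OS-variance form**: for `β ≥ 0`, `S ≥ 1` and
every bounded measurable `Z` on `GaugeConfig 4 (2S+1) G` depending only on the links of the positive
half (`oPosEdges ∪ oSharedEdges`), `0 ≤ osVar μ Θ Z` with `μ = wilsonMeasure ρ β`,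
`Θ = GaugeConfig.timeReflect` — the tree's `wilsonExpectation_oddReflectionPositive` applied to the
centred observable `Z − ∫Z`. [cite: OsterwalderSeiler1978, §2] -/
theorem osVar_timeReflect_nonneg (hρ : Continuous ρ) {β : ℝ} (hβ : 0 ≤ β) (hS : 1 ≤ S)
    {Z : GaugeConfig 4 (2 * S + 1) G → ℂ} (hZ : Measurable Z) (hZb : ∃ B, ∀ U, ‖Z U‖ ≤ B)
    (hZd : DependsOn Z ((WilsonOddRP.oPosEdges ∪ WilsonOddRP.oSharedEdges :
      Finset (Edge 4 (2 * S + 1))) : Set (Edge 4 (2 * S + 1)))) :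
    0 ≤ osVar (wilsonMeasure (d := 4) (L := 2 * S + 1) ρ β) GaugeConfig.timeReflect Z := by
  set μ := wilsonMeasure (d := 4) (L := 2 * S + 1) (G := G) ρ β with hμ
  haveI := isProbabilityMeasure_wilsonMeasure (d := 4) (L := 2 * S + 1) ρ hρ β
  have hΘ : MeasurePreserving (GaugeConfig.timeReflect : GaugeConfig 4 (2 * S + 1) G → _) μ μ :=
    ⟨WilsonRP.measurable_timeReflect,
      Summit.QuantumFields.YangMills.Theorems.FiniteSusceptibilityWeakCoupling.RPCauchySchwarz.wilsonMeasure_map_timeReflect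
        ρ hρ β⟩
  obtain ⟨B, hB⟩ := hZb
  set c : ℂ := ∫ U, Z U ∂μ with hc
  -- the centred observable
  set W : GaugeConfig 4 (2 * S + 1) G → ℂ := fun U => Z U - c with hW
  have hWm : Measurable W := hZ.sub measurable_const
  have hWb : ∃ C : ℝ, ∀ U, ‖W U‖ ≤ C := ⟨B + ‖c‖, fun U => (norm_sub_le _ _).trans (by
    have := hB U; linarith)⟩
  have hWd : DependsOn W ((WilsonOddRP.oPosEdges ∪ WilsonOddRP.oSharedEdges :
      Finset (Edge 4 (2 * S + 1))) : Set (Edge 4 (2 * S + 1))) := fun U V h => by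
    show Z U - c = Z V - c
    rw [hZd h]
  have hRP := wilsonExpectation_oddReflectionPositive ρ ⟨S, by ring⟩ (by omega) hρ hβ W hWm hWb hWd
  -- the reflection-positive quantity of `W` is `osCorr μ Θ id Z Z`
  have hZi : Integrable Z μ := integrable_of_measurable_bounded hZ ⟨B, hB⟩
  have hZΘ : Integrable (fun U => conj (Z U.timeReflect)) μ :=
    integrable_of_measurable_bounded (Complex.continuous_conj.measurable.comp
      (hZ.comp WilsonRP.measurable_timeReflect)) ⟨B, fun U => by rw [RCLike.norm_conj]; exact hB _⟩
  have hZZ : Integrable (fun U => conj (Z U.timeReflect) * Z U) μ :=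
    integrable_conj_comp_mul_comp (τ := id) WilsonRP.measurable_timeReflect measurable_id hZ ⟨B, hB⟩
      hZ ⟨B, hB⟩
  have hcΘ : ∫ U, conj (Z U.timeReflect) ∂μ = conj c := by
    rw [integral_conj, hc]
    exact congrArg _ (integral_comp_eq_of_measurePreserving hΘ hZ)
  have hkey : (∫ U, conj (W U.timeReflect) * W U ∂μ) =
      osCorr μ GaugeConfig.timeReflect id Z Z := by
    have e : ∀ U, conj (W U.timeReflect) * W U =
        conj (Z U.timeReflect) * Z U - c * conj (Z U.timeReflect) - conj c * Z U + conj c * c := by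
      intro U; simp only [hW, map_sub]; ring
    simp_rw [e]
    rw [integral_add, integral_sub, integral_sub, integral_const_mul, integral_const_mul, hcΘ,
      integral_const, hc]
    · simp only [probReal_univ, one_smul, osCorr, id_eq]
      ring
    · exact hZZ
    · exact hZΘ.const_mul c
    · exact hZZ.sub (hZΘ.const_mul c)
    · exact hZi.const_mul _
    · exact (hZZ.sub (hZΘ.const_mul c)).sub (hZi.const_mul _)
    · exact integrable_const _
  unfold osVar
  rw [← hkey]
  exact (Complex.nonneg_iff.1 hRP).1

end RP

/-! ## §3 Slab observables and their time shifts -/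

section Slab

variable {Sd : ℕ}

omit [Group G] [TopologicalSpace G] [IsTopologicalGroup G] [CompactSpace G] [BorelSpace G] in
/-- The time shift by `j` evaluates at the link translated by `j e₀`. [folklore] -/
theorem torusTimeShift_apply (j : ℕ) (U : GaugeConfig 4 Sd G) (e : Edge 4 Sd) :
    torusTimeShift Sd j U e = U (e.1 + Pi.single 0 (j : ZMod Sd), e.2) := by
  have h : Torus.proj Sd (-(Pi.single 0 (j : ℤ))) = -(Pi.single 0 (j : ZMod Sd) : Site 4 Sd) := by
    funext i
    by_cases hi : i = 0
    · subst hi; simp [Torus.proj]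
    · simp [Torus.proj, Pi.single_eq_of_ne hi]
  simp only [torusTimeShift, torusConfigShift_apply, h, sub_neg_eq_add]

omit [Group G] [TopologicalSpace G] [IsTopologicalGroup G] [CompactSpace G] [BorelSpace G] in
/-- **Shifting a slab observable.** If `X` depends only on the links based at lattice times
`a … b`, then `X ∘ τ_j` depends only on the links based at times `a + j … b + j`, provided the
shifted slab does not wrap around the torus (`b + j < Sd`). [folklore] -/
theorem dependsOn_comp_torusTimeShift [NeZero Sd] {α : Type*} {X : GaugeConfig 4 Sd G → α}
    {a b : ℕ} (hX : DependsOn X {e : Edge 4 Sd | a ≤ (e.1 0).val ∧ (e.1 0).val ≤ b}) (j : ℕ)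
    (hbj : b + j < Sd) :
    DependsOn (X ∘ torusTimeShift Sd j) {e : Edge 4 Sd | a + j ≤ (e.1 0).val ∧ (e.1 0).val ≤ b + j} := by
  intro U V hUV
  simp only [Function.comp_apply]
  apply hX
  intro e he
  rw [torusTimeShift_apply, torusTimeShift_apply]
  apply hUV
  simp only [Set.mem_setOf_eq] at he ⊢
  have hj : j < Sd := by omega
  have hval : ((e.1 + Pi.single (0 : Fin 4) (j : ZMod Sd) : Site 4 Sd) 0).val = (e.1 0).val + j := by
    rw [Pi.add_apply, Pi.single_eq_same, ZMod.val_add_of_lt, ZMod.val_natCast_of_lt hj]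
    rw [ZMod.val_natCast_of_lt hj]; omega
  rw [hval]
  omega

omit [Group G] [TopologicalSpace G] [IsTopologicalGroup G] [CompactSpace G] [BorelSpace G] in
/-- A slab inside lattice times `1 … Sd/2` lies in the positive half of the odd-torus reflection.
[folklore] -/
theorem slab_subset_oPosEdges [NeZero Sd] {a b : ℕ} (ha : 1 ≤ a) (hb : b ≤ Sd / 2) :
    {e : Edge 4 Sd | a ≤ (e.1 0).val ∧ (e.1 0).val ≤ b} ⊆
      ((WilsonOddRP.oPosEdges ∪ WilsonOddRP.oSharedEdges : Finset (Edge 4 Sd)) : Set (Edge 4 Sd)) := by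
  intro e he
  simp only [Set.mem_setOf_eq] at he
  rw [Finset.coe_union, Set.mem_union, Finset.mem_coe, WilsonOddRP.mem_oPosEdges]
  exact Or.inl ⟨by omega, by omega⟩

end Slab

/-! ## §4 Log-convexity and OS-currency decay for slab observables of the odd Wilson torus -/

section Main

variable {S : ℕ}

/-- **Hankel log-convexity on the odd Wilson torus.** Let `β ≥ 0`, `S ≥ 1`,
`μ = wilsonMeasure ρ β` on `GaugeConfig 4 (2S+1) G`, `Θ = GaugeConfig.timeReflect`, `τ_m = torusTimeShift (2S+1) m`.
For a bounded measurable `X` depending only on the links based at lattice times `1 … w` and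
`2^J m + w ≤ S` (all dyadic shifts stay in the positive half),
`‖osCorr μ Θ τ_m X X‖^(2^J) ≤ (osVar μ Θ X)^(2^J − 1) · ‖osCorr μ Θ τ_(2^J m) X X‖`.
[cite: FrohlichIsraelLiebSimon1978, §2] -/
theorem norm_osCorr_timeShift_pow_le (hρ : Continuous ρ) {β : ℝ} (hβ : 0 ≤ β) (hS : 1 ≤ S)
    {X : GaugeConfig 4 (2 * S + 1) G → ℂ} (hX : Measurable X) (hXb : ∃ B, ∀ U, ‖X U‖ ≤ B) {w : ℕ}
    (hXd : DependsOn X {e : Edge 4 (2 * S + 1) | 1 ≤ (e.1 0).val ∧ (e.1 0).val ≤ w})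
    {J m : ℕ} (hJm : 2 ^ J * m + w ≤ S) :
    ‖osCorr (wilsonMeasure (d := 4) (L := 2 * S + 1) ρ β) GaugeConfig.timeReflect
        (torusTimeShift (2 * S + 1) m) X X‖ ^ (2 ^ J) ≤
      osVar (wilsonMeasure (d := 4) (L := 2 * S + 1) ρ β) GaugeConfig.timeReflect X ^ (2 ^ J - 1) *
        ‖osCorr (wilsonMeasure (d := 4) (L := 2 * S + 1) ρ β) GaugeConfig.timeReflect
          (torusTimeShift (2 * S + 1) (2 ^ J * m)) X X‖ := by
  set μ := wilsonMeasure (d := 4) (L := 2 * S + 1) (G := G) ρ β with hμ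
  haveI := isProbabilityMeasure_wilsonMeasure (d := 4) (L := 2 * S + 1) ρ hρ β
  -- the data of the abstract lemma
  have hΘm : Measurable (GaugeConfig.timeReflect : GaugeConfig 4 (2 * S + 1) G → _) :=
    WilsonRP.measurable_timeReflect
  have hΘ : MeasurePreserving (GaugeConfig.timeReflect : GaugeConfig 4 (2 * S + 1) G → _) μ μ :=
    ⟨hΘm, Summit.QuantumFields.YangMills.Theorems.FiniteSusceptibilityWeakCoupling.RPCauchySchwarz.wilsonMeasure_map_timeReflect
      ρ hρ β⟩
  have hΘΘ : ∀ U : GaugeConfig 4 (2 * S + 1) G, U.timeReflect.timeReflect = U :=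
    Summit.QuantumFields.YangMills.Theorems.FiniteSusceptibilityWeakCoupling.RPCauchySchwarz.timeReflect_timeReflect
  have hτ : MeasurePreserving (⇑(torusTimeShift (G := G) (2 * S + 1) 1)) μ μ :=
    ⟨(torusTimeShift _ _).measurable, by
      unfold torusTimeShift; exact wilsonMeasure_map_torusConfigShift ρ β _⟩
  set σ : GaugeConfig 4 (2 * S + 1) G → GaugeConfig 4 (2 * S + 1) G :=
    ⇑(torusConfigShift (G := G) (Pi.single 0 (1 : ZMod (2 * S + 1)) : Site 4 (2 * S + 1))) with hσdef
  have hσ : Measurable σ := (torusConfigShift _).measurable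
  have hΘτ : ∀ U : GaugeConfig 4 (2 * S + 1) G,
      torusTimeShift (2 * S + 1) 1 U.timeReflect = (σ U).timeReflect := by
    intro U
    rw [coe_torusTimeShift_one]
    have h := torusConfigShift_timeReflect_comm (G := G) (-1 : ZMod (2 * S + 1)) U
    rw [Pi.single_neg, neg_neg] at h
    exact h
  have hστ : ∀ U : GaugeConfig 4 (2 * S + 1) G, σ (torusTimeShift (2 * S + 1) 1 U) = U := by
    intro U
    rw [coe_torusTimeShift_one]
    exact Summit.QuantumFields.YangMills.Theorems.FiniteSusceptibilityWeakCoupling.RPCauchySchwarz.torusConfigShift_shift_neg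
      (Pi.single 0 1) U
  -- the reflection-positive class: bounded measurable observables of the positive half
  set Good : (GaugeConfig 4 (2 * S + 1) G → ℂ) → Prop := fun Z => Measurable Z ∧ (∃ B, ∀ U, ‖Z U‖ ≤ B) ∧
    DependsOn Z ((WilsonOddRP.oPosEdges ∪ WilsonOddRP.oSharedEdges :
      Finset (Edge 4 (2 * S + 1))) : Set (Edge 4 (2 * S + 1))) with hGood
  have hmeas : ∀ Z, Good Z → Measurable Z := fun Z h => h.1
  have hbdd : ∀ Z, Good Z → ∃ B, ∀ U, ‖Z U‖ ≤ B := fun Z h => h.2.1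
  have hadd : ∀ Z Y (c : ℂ), Good Z → Good Y → Good (Z + c • Y) := by
    rintro Z Y c ⟨hZm, ⟨BZ, hBZ⟩, hZd⟩ ⟨hYm, ⟨BY, hBY⟩, hYd⟩
    refine ⟨hZm.add (hYm.const_smul c), ⟨BZ + ‖c‖ * BY, fun U => ?_⟩, fun U V h => ?_⟩
    · rw [Pi.add_apply, Pi.smul_apply, smul_eq_mul]
      refine (norm_add_le _ _).trans (add_le_add (hBZ U) ?_)
      rw [norm_mul]
      exact mul_le_mul_of_nonneg_left (hBY U) (norm_nonneg _)
    · simp only [Pi.add_apply, Pi.smul_apply, smul_eq_mul]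
      rw [hZd h, hYd h]
  have hvar : ∀ Z, Good Z → 0 ≤ osVar μ GaugeConfig.timeReflect Z := fun Z h =>
    osVar_timeReflect_nonneg ρ hρ hβ hS h.1 h.2.1 h.2.2
  -- `X` and its admissible shifts are good
  obtain ⟨B, hB⟩ := hXb
  have hgoodShift : ∀ n, n + w ≤ S → Good (X ∘ (⇑(torusTimeShift (G := G) (2 * S + 1) 1))^[n]) := by
    intro n hn
    rw [torusTimeShift_one_iterate]
    refine ⟨hX.comp (torusTimeShift _ _).measurable, ⟨B, fun U => hB _⟩, ?_⟩
    have h1 := dependsOn_comp_torusTimeShift hXd n (by omega)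
    exact h1.mono (slab_subset_oPosEdges (by omega) (by omega))
  have hXgood : Good X := by simpa using hgoodShift 0 (by omega)
  have hgood : ∀ j ≤ J, Good (X ∘ (⇑(torusTimeShift (G := G) (2 * S + 1) 1))^[2 ^ j * m]) := by
    intro j hj
    apply hgoodShift
    have : 2 ^ j * m ≤ 2 ^ J * m := Nat.mul_le_mul_right _ (Nat.pow_le_pow_right (by norm_num) hj)
    omega
  have h := norm_osCorr_iterate_pow_le hΘm hΘ hΘΘ hτ hσ hΘτ hστ hmeas hbdd hadd hvar hXgood J m hgood
  simpa only [torusTimeShift_one_iterate] using h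

/-- **OS-currency decay from far-separation decay on the odd Wilson torus.** Under the hypotheses
of `norm_osCorr_timeShift_pow_le`, ANY bound `‖osCorr μ Θ τ_(2^J m) X X‖ ≤ C e^{−κ 2^J m}` at the
far separation (e.g. sup-norm exponential clustering of the torus state) gives
`‖osCorr μ Θ τ_m X X‖ ≤ ((osVar μ Θ X)^(2^J − 1) C)^{2^{−J}} e^{−κ m}` — the reflected autocorrelation in
OS currency at the same rate, up to the loss factor `(C / osVar X)^{2^{−J}}`.
[cite: FrohlichIsraelLiebSimon1978, §2] [cite: GlimmJaffe1987, §19.7] -/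
theorem norm_osCorr_timeShift_le_of_decay (hρ : Continuous ρ) {β : ℝ} (hβ : 0 ≤ β) (hS : 1 ≤ S)
    {X : GaugeConfig 4 (2 * S + 1) G → ℂ} (hX : Measurable X) (hXb : ∃ B, ∀ U, ‖X U‖ ≤ B) {w : ℕ}
    (hXd : DependsOn X {e : Edge 4 (2 * S + 1) | 1 ≤ (e.1 0).val ∧ (e.1 0).val ≤ w})
    {J m : ℕ} (hJm : 2 ^ J * m + w ≤ S) {C κ : ℝ}
    (hfar : ‖osCorr (wilsonMeasure (d := 4) (L := 2 * S + 1) ρ β) GaugeConfig.timeReflect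
        (torusTimeShift (2 * S + 1) (2 ^ J * m)) X X‖ ≤ C * Real.exp (-(κ * (2 ^ J * m)))) :
    ‖osCorr (wilsonMeasure (d := 4) (L := 2 * S + 1) ρ β) GaugeConfig.timeReflect
        (torusTimeShift (2 * S + 1) m) X X‖ ≤
      (osVar (wilsonMeasure (d := 4) (L := 2 * S + 1) ρ β) GaugeConfig.timeReflect X ^ (2 ^ J - 1) * C) ^
          ((2 ^ J : ℝ)⁻¹) * Real.exp (-(κ * m)) := by
  have hiter := norm_osCorr_timeShift_pow_le ρ hρ hβ hS hX hXb hXd hJm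
  have hV : 0 ≤ osVar (wilsonMeasure (d := 4) (L := 2 * S + 1) ρ β) GaugeConfig.timeReflect X := by
    obtain ⟨B, hB⟩ := hXb
    refine osVar_timeReflect_nonneg ρ hρ hβ hS hX ⟨B, hB⟩ (hXd.mono (slab_subset_oPosEdges le_rfl ?_))
    have : w ≤ S := by have := Nat.zero_le (2 ^ J * m); omega
    omega
  -- as in the abstract `norm_osCorr_iterate_le_of_decay`
  set x := ‖osCorr (wilsonMeasure (d := 4) (L := 2 * S + 1) ρ β) GaugeConfig.timeReflect
        (torusTimeShift (2 * S + 1) m) X X‖ with hx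
  set V := osVar (wilsonMeasure (d := 4) (L := 2 * S + 1) ρ β) GaugeConfig.timeReflect X with hVdef
  have hN : (2 ^ J : ℕ) ≠ 0 := by positivity
  have hexp : Real.exp (-(κ * (2 ^ J * m))) = Real.exp (-(κ * m)) ^ (2 ^ J : ℕ) := by
    rw [← Real.exp_nat_mul]; congr 1; push_cast; ring
  have hmain : x ^ (2 ^ J : ℕ) ≤ (V ^ (2 ^ J - 1) * C) * Real.exp (-(κ * m)) ^ (2 ^ J : ℕ) := by
    refine hiter.trans ?_
    rw [mul_assoc]
    refine mul_le_mul_of_nonneg_left ?_ (by positivity)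
    rw [← hexp]; exact hfar
  have hE : 0 < Real.exp (-(κ * m)) := Real.exp_pos _
  have hq : (x / Real.exp (-(κ * m))) ^ (2 ^ J : ℕ) ≤ V ^ (2 ^ J - 1) * C := by
    rw [div_pow, div_le_iff₀ (by positivity)]
    exact hmain
  have hx0 : 0 ≤ x / Real.exp (-(κ * m)) := div_nonneg (norm_nonneg _) hE.le
  have hroot : x / Real.exp (-(κ * m)) ≤ (V ^ (2 ^ J - 1) * C) ^ ((2 ^ J : ℝ)⁻¹) := by
    have h1 : ((x / Real.exp (-(κ * m))) ^ (2 ^ J : ℕ)) ^ (((2 ^ J : ℕ) : ℝ)⁻¹)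
        ≤ (V ^ (2 ^ J - 1) * C) ^ (((2 ^ J : ℕ) : ℝ)⁻¹) :=
      Real.rpow_le_rpow (pow_nonneg hx0 _) hq (by positivity)
    rw [Real.pow_rpow_inv_natCast hx0 hN] at h1
    simpa using h1
  rw [div_le_iff₀ hE] at hroot
  simpa using hroot

end Main

end Hankel

end Transfer

end Summit.QuantumFields.YangMills.Cruxes.LatticeGapOnTrajectory.OrbitKantorovichFiniteSize

end
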